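import Summits.QuantumFields.BalabanUV.T4Continuum.Support.RegionStarTrace

/-!
# T⁴ programme, spine node NE2 (U1a), sub-row Δ1 «NE2⁰-Dirichlet» — THE WEIGHTED DISCRETE TRACE INEQUALITY ON THE INWARD SPIKES of an
# arbitrary union of blocks: `Σ_{deficient b} ‖u b‖² ≤ 2‖u‖²/n + (2K/n²)·Σ_ν Σ_y W(y)‖(igrad_ν u)(y)‖²` for ANY positive bond weight `W`
# whose reciprocals sum to at most `K` along every spike column

NE2 formalisation swarm `b2b-balaban-t4-ne2-formalise-*`, LEAF PROVER 09 (gen 10), file F-W1 of the route r5 of memo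
`t4/T4-EST-NE2-D1-CORNER.md` §4 (journal `HOME/CLAIMS.log` 2026-08-21 l.23790 / l.24306).  leaf-06-g6's `RegionStarTrace.trace_deficient_le`
(`Σ_def ‖u b‖² ≤ (2‖u‖² + Σ_ν‖igrad_ν u‖²)/n`, the input of the (Bᵗ) leaf `RegionGaugeColumnsTrace.sum_deficient_normSq_regionBh_le`) pays
the trace of a star-bond field on the exposed faces with the UNWEIGHTED second differences along the full inward columns — on a re-entrant
region that is the interior Hessian near the edges, whose level growth is the corner mass of `DirichletCornerRegularity` (the budget route's
wall).  THIS FILE proves the same trace inequality with an ARBITRARY positive weight `W` on the column differences: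

 * §1 **`path_avg_weighted`** (1D): `n·‖w 0‖² ≤ 2·Σ_{s<n}‖w s‖² + 2n·(Σ_{r<n−1} ω_r⁻¹)·Σ_{r<n−1} ω_r‖w(r+1) − w r‖²` for positive `ω`
   (weighted Cauchy–Schwarz along the path, averaged over the foot's height);
 * §2 **`spike_le_weighted`** (one inward spike, the column bonds weighted by `W ∘ cpt`);
 * §3 **THE END `trace_deficient_le_weighted (u) (W) (hW : ∀ c, 0 < W c) (hK : ∀ b ∈ defSet, Σ_{r<n−1} (W (cpt b r))⁻¹ ≤ K)` :
   `Σ_{b ∈ defSet} ‖u b‖² ≤ 2·nsq u / n + (2K/n²)·Σ_ν Σ_y W y.1 · ‖(igrad M S n ν u) y‖²`** — ANY union of blocks, ANY level `n ≥ 1`, ANY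
   star-bond field; `W ≡ 1` (`K = n − 1`) returns leaf-06-g6's inequality up to the constant.  USE (memo §4 (W-T)): with
   `W(x, ν) = ((s+1)² + j²)^{p/2}` along the column (height `s`, in-face edge distance `j`; `p ∈ (1, 2)`) the reciprocal sums are bounded by
   `ζ(p)`-type constants UNIFORMLY in the column, including the columns adjacent to a re-entrant edge, and the weighted Hessian on the right
   is the one controlled level-uniformly by the dyadic cutoff family of `DirichletCornerCutoffH2` — the deficient-layer trace no longer sees the
   corner mass.  The weight/geometry (`hK` for box holes) is a separate file.

HONEST FRAMING (T4-DAG p. 1).  [folklore] finite lattice calculus on the cell's typed `U = 1` star-bond objects (one region, finite torus); the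
weight is DATA with a displayed reciprocal-sum bound; no estimate of any NE row by itself; `hinjK` ∕ W3 off boxes OPEN; Δ1 NOT closed; NE2 (U1a)
NOT proved; spine PROVED 0/9 unchanged; NOT [B9] (3.16)/(3.23)–(3.27) as printed; NOT infinite volume, NOT a mass gap, NOT the Clay problem.
HONEST DEPENDENCY: continuum YM on T⁴ ⇐ BetaPertH ∧ nine spine estimates (0/9 proved); BetaPertH ⇐ (D1) ∧ (D4) ∧ CAP+tail; G-an2-4 gates asym,
D1 and NE2/3/4.  No `sorry`.
-/

noncomputable section

open scoped BigOperators ComplexConjugate Matrix Matrix.Norms.L2Operator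
open Finset

namespace Summit.QuantumFields.BalabanUV.T4Continuum.RegionStarTraceWeighted

open Literature.MathematicalPhysics.QuantumFieldTheory.Balaban1983to89.B5Prop11Plancherel (Tor fine unitVec)
open Literature.MathematicalPhysics.QuantumFieldTheory.Balaban1983to89.B5Prop11Lower (nsq nsq_nonneg)
open Literature.MathematicalPhysics.QuantumFieldTheory.Balaban1983to89.B5Block118 (tstep tstep_zero tstep_succ)
open Summit.QuantumFields.BalabanUV.T4Continuum
open Summit.QuantumFields.BalabanUV.T4Continuum.SubtypeCompression (ext ext_apply_of nsq_ext)
open Summit.QuantumFields.BalabanUV.T4Continuum.RegionGaugeFixedVector (starReg)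
open Summit.QuantumFields.BalabanUV.T4Continuum.DirichletStarRenormTower (igrad)
open Summit.QuantumFields.BalabanUV.T4Continuum.RegionFaceFluxChart (gI gI_nonneg sum_gI_eq gI_eq_of_star)
open Summit.QuantumFields.BalabanUV.T4Continuum.RegionStarTrace (norm_sq_le_two cpt cpt_succ defSet mem_defSet star_add_tstep
  sum_columns_le)
open Summit.QuantumFields.BalabanUV.Beta.GAN24.DirichletBoxTrace (blockReg)

/-! ## §1 The weighted averaged path inequality -/

/-- **weighted Cauchy–Schwarz along a path**: for positive weights `ω`,
`‖w b − w a‖² ≤ (Σ_{r∈[a,b)} ω_r⁻¹)·Σ_{r∈[a,b)} ω_r‖w(r+1) − w r‖²`. [folklore] -/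
theorem norm_sub_sq_le_path_weighted (w : ℕ → ℂ) {ω : ℕ → ℝ} (hω : ∀ r, 0 < ω r) {a b : ℕ} (hab : a ≤ b) :
    ‖w b - w a‖ ^ 2 ≤ (∑ r ∈ Ico a b, (ω r)⁻¹) * ∑ r ∈ Ico a b, ω r * ‖w (r + 1) - w r‖ ^ 2 := by
  have htel : w b - w a = ∑ s ∈ Ico a b, (w (s + 1) - w s) := by
    rw [Finset.sum_Ico_eq_sum_range]
    have h := Finset.sum_range_sub (fun k => w (a + k)) (b - a)
    simp only [Nat.add_sub_cancel' hab, add_zero] at h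
    rw [← h]
    exact sum_congr rfl fun k _ => by rw [add_assoc]
  have h1 : ‖w b - w a‖ ≤ ∑ s ∈ Ico a b, Real.sqrt ((ω s)⁻¹) * (Real.sqrt (ω s) * ‖w (s + 1) - w s‖) := by
    rw [htel]
    refine (norm_sum_le _ _).trans (le_of_eq (sum_congr rfl fun s _ => ?_))
    rw [← mul_assoc, ← Real.sqrt_mul (inv_nonneg.mpr (hω s).le), inv_mul_cancel₀ (hω s).ne', Real.sqrt_one, one_mul]
  have h0 : 0 ≤ ‖w b - w a‖ := norm_nonneg _
  calc ‖w b - w a‖ ^ 2 ≤ (∑ s ∈ Ico a b, Real.sqrt ((ω s)⁻¹) * (Real.sqrt (ω s) * ‖w (s + 1) - w s‖)) ^ 2 := pow_le_pow_left₀ h0 h1 2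
    _ ≤ (∑ s ∈ Ico a b, Real.sqrt ((ω s)⁻¹) ^ 2) * ∑ s ∈ Ico a b, (Real.sqrt (ω s) * ‖w (s + 1) - w s‖) ^ 2 :=
        sum_mul_sq_le_sq_mul_sq _ _ _
    _ = (∑ r ∈ Ico a b, (ω r)⁻¹) * ∑ r ∈ Ico a b, ω r * ‖w (r + 1) - w r‖ ^ 2 := by
        congr 1
        · exact sum_congr rfl fun s _ => Real.sq_sqrt (inv_nonneg.mpr (hω s).le)
        · exact sum_congr rfl fun s _ => by rw [mul_pow, Real.sq_sqrt (hω s).le]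

/-- **THE WEIGHTED AVERAGED PATH INEQUALITY**: for positive weights `ω`,
`n·‖w 0‖² ≤ 2·Σ_{s<n} ‖w s‖² + 2n·(Σ_{r<n−1} ω_r⁻¹)·Σ_{r<n−1} ω_r‖w(r+1) − w r‖²`. [folklore] -/
theorem path_avg_weighted (w : ℕ → ℂ) {ω : ℕ → ℝ} (hω : ∀ r, 0 < ω r) (n : ℕ) :
    (n : ℝ) * ‖w 0‖ ^ 2
      ≤ 2 * ∑ s ∈ range n, ‖w s‖ ^ 2
        + 2 * n * ((∑ r ∈ range (n - 1), (ω r)⁻¹) * ∑ r ∈ range (n - 1), ω r * ‖w (r + 1) - w r‖ ^ 2) := by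
  set K := ∑ r ∈ range (n - 1), (ω r)⁻¹ with hK
  set Δ := ∑ r ∈ range (n - 1), ω r * ‖w (r + 1) - w r‖ ^ 2 with hΔ
  have hK0 : 0 ≤ K := sum_nonneg fun r _ => inv_nonneg.mpr (hω r).le
  have hΔ0 : 0 ≤ Δ := sum_nonneg fun r _ => mul_nonneg (hω r).le (by positivity)
  -- each height: `‖w 0‖² ≤ 2‖w s‖² + 2 K Δ`
  have hs : ∀ s ∈ range n, ‖w 0‖ ^ 2 ≤ 2 * ‖w s‖ ^ 2 + 2 * (K * Δ) := by
    intro s hs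
    have hsn : s < n := mem_range.mp hs
    have hp := norm_sub_sq_le_path_weighted w hω (Nat.zero_le s)
    rw [Nat.Ico_zero_eq_range] at hp
    have hsub1 : ∑ r ∈ range s, (ω r)⁻¹ ≤ K :=
      sum_le_sum_of_subset_of_nonneg (range_subset_range.mpr (Nat.le_sub_one_of_lt hsn)) fun r _ _ => inv_nonneg.mpr (hω r).le
    have hsub2 : ∑ r ∈ range s, ω r * ‖w (r + 1) - w r‖ ^ 2 ≤ Δ :=
      sum_le_sum_of_subset_of_nonneg (range_subset_range.mpr (Nat.le_sub_one_of_lt hsn)) fun r _ _ =>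
        mul_nonneg (hω r).le (by positivity)
    have h1 : ‖w s - w 0‖ ^ 2 ≤ K * Δ :=
      hp.trans (mul_le_mul hsub1 hsub2 (sum_nonneg fun r _ => mul_nonneg (hω r).le (by positivity)) hK0)
    linarith [norm_sq_le_two (w 0) (w s)]
  have hsum := sum_le_sum hs
  rw [sum_const, card_range, nsmul_eq_mul, sum_add_distrib, ← mul_sum, sum_const, card_range, nsmul_eq_mul] at hsum
  linarith

/-! ## §2 One weighted spike -/

section Spike

variable {d : ℕ} (n : ℕ) [NeZero n] (M : Fin d → ℕ) [hM : ∀ μ, NeZero (M μ)] (S : Tor M → Prop) [DecidablePred S]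

/-- **ONE WEIGHTED SPIKE**: for a deficient star bond `b = (x, ν)` and a positive bond weight `W`,
`n²·‖u b‖² ≤ 2n·Σ_{s<n} ‖ιu (cpt b s)‖² + 2·(Σ_{r<n−1} W(cpt b r)⁻¹)·Σ_{r<n} W(cpt b r)·gI_ν u (cpt b r)`. [folklore] -/
theorem spike_le_weighted (u : {b // starReg n M S b} → ℂ) (b : {b // starReg n M S b}) (hx : ¬ blockReg n M S b.1.1)
    (W : Tor (fine n M) × Fin d → ℝ) (hW : ∀ c, 0 < W c) :
    (n : ℝ) ^ 2 * ‖u b‖ ^ 2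
      ≤ 2 * n * ∑ s ∈ range n, ‖ext (starReg n M S) u (cpt n M b.1 s)‖ ^ 2
        + 2 * ((∑ r ∈ range (n - 1), (W (cpt n M b.1 r))⁻¹) * ∑ r ∈ range n, W (cpt n M b.1 r) * gI n M S b.1.2 u (cpt n M b.1 r)) := by
  have hn : (0 : ℝ) ≤ n := Nat.cast_nonneg n
  have hp := path_avg_weighted (fun s => ext (starReg n M S) u (cpt n M b.1 s)) (ω := fun r => W (cpt n M b.1 r)) (fun r => hW _) n
  have h0 : ext (starReg n M S) u (cpt n M b.1 0) = u b := by
    have e : cpt n M b.1 0 = b.1 := by unfold cpt; rw [tstep_zero, add_zero]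
    rw [e]; exact ext_apply_of _ u b
  simp only [h0] at hp
  -- the weighted differences are the weighted `gI` up to the factor `n²`
  have hdiff : ∀ r ∈ range (n - 1), (n : ℝ) ^ 2 * (W (cpt n M b.1 r)
        * ‖ext (starReg n M S) u (cpt n M b.1 (r + 1)) - ext (starReg n M S) u (cpt n M b.1 r)‖ ^ 2)
      = W (cpt n M b.1 r) * gI n M S b.1.2 u (cpt n M b.1 r) := by
    intro r hr
    have hr' : r + 1 ≤ n := by have := mem_range.mp hr; omega
    have hc : starReg n M S (cpt n M b.1 r) := star_add_tstep n M S b.2 hx (by omega)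
    have hc' : starReg n M S ((cpt n M b.1 r).1 + unitVec (fine n M) b.1.2, (cpt n M b.1 r).2) := by
      have e : ((cpt n M b.1 r).1 + unitVec (fine n M) b.1.2, (cpt n M b.1 r).2) = cpt n M b.1 (r + 1) := (cpt_succ n M b.1 r).symm
      rw [e]; exact star_add_tstep n M S b.2 hx hr'
    have e2 : ((cpt n M b.1 r).1 + unitVec (fine n M) b.1.2, (cpt n M b.1 r).2) = cpt n M b.1 (r + 1) := (cpt_succ n M b.1 r).symm
    rw [gI_eq_of_star n M S b.1.2 u (cpt n M b.1 r) hc hc', e2]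
    ring
  have hsum : (n : ℝ) ^ 2 * ∑ r ∈ range (n - 1), W (cpt n M b.1 r)
        * ‖ext (starReg n M S) u (cpt n M b.1 (r + 1)) - ext (starReg n M S) u (cpt n M b.1 r)‖ ^ 2
      ≤ ∑ r ∈ range n, W (cpt n M b.1 r) * gI n M S b.1.2 u (cpt n M b.1 r) := by
    rw [mul_sum, sum_congr rfl hdiff]
    exact sum_le_sum_of_subset_of_nonneg (range_subset_range.mpr (Nat.sub_le n 1)) fun r _ _ =>
      mul_nonneg (hW _).le (gI_nonneg n M S _ u _)
  have hK0 : 0 ≤ ∑ r ∈ range (n - 1), (W (cpt n M b.1 r))⁻¹ := sum_nonneg fun r _ => inv_nonneg.mpr (hW _).le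
  have hkey := mul_le_mul_of_nonneg_left hsum hK0
  -- multiply the averaged path inequality by `n`
  have hp' := mul_le_mul_of_nonneg_left hp hn
  have e : (n : ℝ) * ((n : ℝ) * ‖u b‖ ^ 2) = (n : ℝ) ^ 2 * ‖u b‖ ^ 2 := by ring
  rw [e] at hp'
  nlinarith [hp', hkey]

end Spike

/-! ## §3 The weighted trace inequality -/

section Trace

variable {d : ℕ} (n : ℕ) [NeZero n] (M : Fin d → ℕ) [hM : ∀ μ, NeZero (M μ)] (S : Tor M → Prop) [DecidablePred S]

/-- the weighted `gI` sums over all bonds are the weighted squares of `igrad` over the star bonds. [folklore] -/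
theorem sum_weight_mul_gI_eq (W : Tor (fine n M) × Fin d → ℝ) (ν : Fin d) (u : {b // starReg n M S b} → ℂ) :
    ∑ c, W c * gI n M S ν u c = ∑ y : {b // starReg n M S b}, W y.1 * ‖igrad M S n ν u y‖ ^ 2 := by
  unfold gI
  rw [← Fintype.sum_subtype_add_sum_subtype (starReg n M S)
    (fun c => W c * (if h : starReg n M S c then ‖igrad M S n ν u ⟨c, h⟩‖ ^ 2 else 0))]
  have h0 : ∑ c : {c // ¬ starReg n M S c}, W c.1 * (if h : starReg n M S c.1 then ‖igrad M S n ν u ⟨c.1, h⟩‖ ^ 2 else 0) = 0 :=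
    Finset.sum_eq_zero fun c _ => by rw [dif_neg c.2, mul_zero]
  rw [h0, add_zero]
  exact Finset.sum_congr rfl fun y _ => by rw [dif_pos y.2]

/-- **THE WEIGHTED DISCRETE TRACE INEQUALITY ON THE INWARD SPIKES** of an arbitrary union of blocks, at every level `n ≥ 1`, for every
star-bond field `u` and every positive bond weight `W` whose reciprocals sum to at most `K ≥ 0` along every spike column:
`Σ_{deficient b} ‖u b‖² ≤ 2·nsq u / n + (2K/n²)·Σ_ν Σ_y W(y) · ‖(igrad_ν u)(y)‖²`. [folklore] -/
theorem trace_deficient_le_weighted (u : {b // starReg n M S b} → ℂ) (W : Tor (fine n M) × Fin d → ℝ) (hW : ∀ c, 0 < W c) {K : ℝ}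
    (hK0 : 0 ≤ K) (hK : ∀ b ∈ defSet n M S, ∑ r ∈ range (n - 1), (W (cpt n M b.1 r))⁻¹ ≤ K) :
    ∑ b ∈ defSet n M S, ‖u b‖ ^ 2
      ≤ 2 * nsq u / n + 2 * K / (n : ℝ) ^ 2 * ∑ ν, ∑ y : {b // starReg n M S b}, W y.1 * ‖igrad M S n ν u y‖ ^ 2 := by
  have hn : (0 : ℝ) < n := by exact_mod_cast Nat.pos_of_ne_zero (NeZero.ne n)
  -- sum the weighted spikes
  have h1 : ∑ b ∈ defSet n M S, (n : ℝ) ^ 2 * ‖u b‖ ^ 2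
      ≤ ∑ b ∈ defSet n M S, (2 * n * ∑ s ∈ range n, ‖ext (starReg n M S) u (cpt n M b.1 s)‖ ^ 2
          + 2 * (K * ∑ r ∈ range n, W (cpt n M b.1 r) * gI n M S b.1.2 u (cpt n M b.1 r))) := by
    refine sum_le_sum fun b hb => ?_
    refine (spike_le_weighted n M S u b ((mem_defSet n M S).mp hb) W hW).trans (add_le_add le_rfl ?_)
    refine mul_le_mul_of_nonneg_left ?_ (by norm_num)
    exact mul_le_mul_of_nonneg_right (hK b hb) (sum_nonneg fun r _ => mul_nonneg (hW _).le (gI_nonneg n M S _ u _))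
  -- the column masses count every bond at most once
  have h2 : ∑ b ∈ defSet n M S, ∑ s ∈ range n, ‖ext (starReg n M S) u (cpt n M b.1 s)‖ ^ 2 ≤ nsq u := by
    rw [← nsq_ext (starReg n M S) u]
    exact sum_columns_le n M S (fun c => ‖ext (starReg n M S) u c‖ ^ 2) fun c => by positivity
  -- the weighted `gI` over the columns against the weighted `igrad` energies
  have h3 : ∑ b ∈ defSet n M S, ∑ r ∈ range n, W (cpt n M b.1 r) * gI n M S b.1.2 u (cpt n M b.1 r)
      ≤ ∑ ν, ∑ y : {b // starReg n M S b}, W y.1 * ‖igrad M S n ν u y‖ ^ 2 := by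
    have h3a := sum_columns_le n M S (fun c => W c * gI n M S c.2 u c) fun c => mul_nonneg (hW c).le (gI_nonneg n M S _ u _)
    have h3b : ∑ c : Tor (fine n M) × Fin d, W c * gI n M S c.2 u c ≤ ∑ c : Tor (fine n M) × Fin d, ∑ ν, W c * gI n M S ν u c :=
      sum_le_sum fun c _ => single_le_sum (f := fun ν => W c * gI n M S ν u c)
        (fun ν _ => mul_nonneg (hW c).le (gI_nonneg n M S ν u c)) (mem_univ c.2)
    rw [sum_comm] at h3b
    simp only [sum_weight_mul_gI_eq] at h3b
    exact h3a.trans h3b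
  rw [sum_add_distrib, ← mul_sum, ← mul_sum, ← mul_sum] at h1
  set X := ∑ ν, ∑ y : {b // starReg n M S b}, W y.1 * ‖igrad M S n ν u y‖ ^ 2 with hX
  have h4 : (n : ℝ) ^ 2 * ∑ b ∈ defSet n M S, ‖u b‖ ^ 2 ≤ 2 * n * nsq u + 2 * (K * X) := by
    refine h1.trans (add_le_add ?_ ?_)
    · exact mul_le_mul_of_nonneg_left h2 (by positivity)
    · refine mul_le_mul_of_nonneg_left ?_ (by norm_num)
      rw [← mul_sum]
      exact mul_le_mul_of_nonneg_left h3 hK0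
  -- divide by `n²`
  have hn2 : (0 : ℝ) < (n : ℝ) ^ 2 := pow_pos hn 2
  rw [← sub_nonneg]
  have e : 2 * nsq u / n + 2 * K / (n : ℝ) ^ 2 * X - ∑ b ∈ defSet n M S, ‖u b‖ ^ 2
      = (2 * n * nsq u + 2 * (K * X) - (n : ℝ) ^ 2 * ∑ b ∈ defSet n M S, ‖u b‖ ^ 2) / (n : ℝ) ^ 2 := by
    field_simp
  rw [e]
  exact div_nonneg (by linarith) hn2.le

/-- **THE WEIGHTED TRACE, DIAGONAL FORM** (v1.1): the same with the right-hand side restricted to the second differences ALONG each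
bond's own direction, `Σ_{deficient b} ‖u b‖² ≤ 2·nsq u / n + (2K/n²)·Σ_c W(c)·gI_{c.2} u c` — every spike column is straight, so only
the diagonal interior gradient `igrad_{c.2}` of the column's bonds is ever used (for `u = ∂z` these are the DIAGONAL second differences
`P_μ z`, the quantity the corner-cutoff `H²` bounds control; the all-directions form above is this one weakened). [folklore] -/
theorem trace_deficient_le_weighted_diag (u : {b // starReg n M S b} → ℂ) (W : Tor (fine n M) × Fin d → ℝ) (hW : ∀ c, 0 < W c)
    {K : ℝ} (hK0 : 0 ≤ K) (hK : ∀ b ∈ defSet n M S, ∑ r ∈ range (n - 1), (W (cpt n M b.1 r))⁻¹ ≤ K) :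
    ∑ b ∈ defSet n M S, ‖u b‖ ^ 2
      ≤ 2 * nsq u / n + 2 * K / (n : ℝ) ^ 2 * ∑ c : Tor (fine n M) × Fin d, W c * gI n M S c.2 u c := by
  have hn : (0 : ℝ) < n := by exact_mod_cast Nat.pos_of_ne_zero (NeZero.ne n)
  have h1 : ∑ b ∈ defSet n M S, (n : ℝ) ^ 2 * ‖u b‖ ^ 2
      ≤ ∑ b ∈ defSet n M S, (2 * n * ∑ s ∈ range n, ‖ext (starReg n M S) u (cpt n M b.1 s)‖ ^ 2
          + 2 * (K * ∑ r ∈ range n, W (cpt n M b.1 r) * gI n M S b.1.2 u (cpt n M b.1 r))) := by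
    refine sum_le_sum fun b hb => ?_
    refine (spike_le_weighted n M S u b ((mem_defSet n M S).mp hb) W hW).trans (add_le_add le_rfl ?_)
    refine mul_le_mul_of_nonneg_left ?_ (by norm_num)
    exact mul_le_mul_of_nonneg_right (hK b hb) (sum_nonneg fun r _ => mul_nonneg (hW _).le (gI_nonneg n M S _ u _))
  have h2 : ∑ b ∈ defSet n M S, ∑ s ∈ range n, ‖ext (starReg n M S) u (cpt n M b.1 s)‖ ^ 2 ≤ nsq u := by
    rw [← nsq_ext (starReg n M S) u]
    exact sum_columns_le n M S (fun c => ‖ext (starReg n M S) u c‖ ^ 2) fun c => by positivity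
  have h3 : ∑ b ∈ defSet n M S, ∑ r ∈ range n, W (cpt n M b.1 r) * gI n M S b.1.2 u (cpt n M b.1 r)
      ≤ ∑ c : Tor (fine n M) × Fin d, W c * gI n M S c.2 u c :=
    sum_columns_le n M S (fun c => W c * gI n M S c.2 u c) fun c => mul_nonneg (hW c).le (gI_nonneg n M S _ u _)
  rw [sum_add_distrib, ← mul_sum, ← mul_sum, ← mul_sum] at h1
  set X := ∑ c : Tor (fine n M) × Fin d, W c * gI n M S c.2 u c with hX
  have h4 : (n : ℝ) ^ 2 * ∑ b ∈ defSet n M S, ‖u b‖ ^ 2 ≤ 2 * n * nsq u + 2 * (K * X) := by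
    refine h1.trans (add_le_add ?_ ?_)
    · exact mul_le_mul_of_nonneg_left h2 (by positivity)
    · refine mul_le_mul_of_nonneg_left ?_ (by norm_num)
      rw [← mul_sum]
      exact mul_le_mul_of_nonneg_left h3 hK0
  have hn2 : (0 : ℝ) < (n : ℝ) ^ 2 := pow_pos hn 2
  rw [← sub_nonneg]
  have e : 2 * nsq u / n + 2 * K / (n : ℝ) ^ 2 * X - ∑ b ∈ defSet n M S, ‖u b‖ ^ 2
      = (2 * n * nsq u + 2 * (K * X) - (n : ℝ) ^ 2 * ∑ b ∈ defSet n M S, ‖u b‖ ^ 2) / (n : ℝ) ^ 2 := by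
    field_simp
  rw [e]
  exact div_nonneg (by linarith) hn2.le

/-- **THE WEIGHTED TRACE, PER-COLUMN FORM** (v1.1): the right-hand side kept as the sum over the deficient columns themselves,
`Σ_{deficient b} ‖u b‖² ≤ 2·nsq u / n + (2K/n²)·Σ_{deficient b} Σ_{r<n} W(cpt b r)·gI_{b.2} u (cpt b r)` — the columns are disjoint
(`cpt_injOn`), so a weight defined column by column (e.g. `W(cpt b r) = (r+1)^p`, depth from the exposed face, `Σ_r W⁻¹ ≤ ζ(p)`) is
a legitimate `W`, and only the one-block collar beyond the exposed faces is ever charged. [folklore] -/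
theorem trace_deficient_le_weighted_cols (u : {b // starReg n M S b} → ℂ) (W : Tor (fine n M) × Fin d → ℝ) (hW : ∀ c, 0 < W c)
    {K : ℝ} (hK : ∀ b ∈ defSet n M S, ∑ r ∈ range (n - 1), (W (cpt n M b.1 r))⁻¹ ≤ K) :
    ∑ b ∈ defSet n M S, ‖u b‖ ^ 2
      ≤ 2 * nsq u / n
        + 2 * K / (n : ℝ) ^ 2 * ∑ b ∈ defSet n M S, ∑ r ∈ range n, W (cpt n M b.1 r) * gI n M S b.1.2 u (cpt n M b.1 r) := by
  have hn : (0 : ℝ) < n := by exact_mod_cast Nat.pos_of_ne_zero (NeZero.ne n)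
  have h1 : ∑ b ∈ defSet n M S, (n : ℝ) ^ 2 * ‖u b‖ ^ 2
      ≤ ∑ b ∈ defSet n M S, (2 * n * ∑ s ∈ range n, ‖ext (starReg n M S) u (cpt n M b.1 s)‖ ^ 2
          + 2 * (K * ∑ r ∈ range n, W (cpt n M b.1 r) * gI n M S b.1.2 u (cpt n M b.1 r))) := by
    refine sum_le_sum fun b hb => ?_
    refine (spike_le_weighted n M S u b ((mem_defSet n M S).mp hb) W hW).trans (add_le_add le_rfl ?_)
    refine mul_le_mul_of_nonneg_left ?_ (by norm_num)
    exact mul_le_mul_of_nonneg_right (hK b hb) (sum_nonneg fun r _ => mul_nonneg (hW _).le (gI_nonneg n M S _ u _))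
  have h2 : ∑ b ∈ defSet n M S, ∑ s ∈ range n, ‖ext (starReg n M S) u (cpt n M b.1 s)‖ ^ 2 ≤ nsq u := by
    rw [← nsq_ext (starReg n M S) u]
    exact sum_columns_le n M S (fun c => ‖ext (starReg n M S) u c‖ ^ 2) fun c => by positivity
  rw [sum_add_distrib, ← mul_sum, ← mul_sum, ← mul_sum] at h1
  set X := ∑ b ∈ defSet n M S, ∑ r ∈ range n, W (cpt n M b.1 r) * gI n M S b.1.2 u (cpt n M b.1 r) with hX
  have h4 : (n : ℝ) ^ 2 * ∑ b ∈ defSet n M S, ‖u b‖ ^ 2 ≤ 2 * n * nsq u + 2 * (K * X) :=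
    h1.trans (add_le_add (mul_le_mul_of_nonneg_left h2 (by positivity)) (by rw [← mul_sum]))
  have hn2 : (0 : ℝ) < (n : ℝ) ^ 2 := pow_pos hn 2
  rw [← sub_nonneg]
  have e : 2 * nsq u / n + 2 * K / (n : ℝ) ^ 2 * X - ∑ b ∈ defSet n M S, ‖u b‖ ^ 2
      = (2 * n * nsq u + 2 * (K * X) - (n : ℝ) ^ 2 * ∑ b ∈ defSet n M S, ‖u b‖ ^ 2) / (n : ℝ) ^ 2 := by
    field_simp
  rw [e]
  exact div_nonneg (by linarith) hn2.le

end Trace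

end Summit.QuantumFields.BalabanUV.T4Continuum.RegionStarTraceWeighted

end
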